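/-
Copyright (c) 2026 the pub-hodgecm-mathlib formalisation cell (harness21).  Prover seat hodgecm-mathlib-LH4-p02 (g8): LH4-plan (g6) WORD #38 «FULL CAYLEY CHART OF THE
NORM-ONE TORUS» (sequel of ★ `NormOneTorusCayleyLevelShift`; the whole torus, not only its deep part, read through skew Cayley parameters); 2026-09-02.
-/
import Literature.NumberTheory.LocalFields.NormOneTorusCayleyLevelShift   -- ★ p851647 (this seat): skew ball ↔ deep norm-one levels; brings ★ `CayleyLevelShift` and Mathlib `Valued`
import HarnessLib

/-!
# The FULL Cayley chart of the norm-one torus: `x ↦ (1 + x)∕(1 − x)` is a bijection `{σ x = −x} → {σ y · y = 1, y ≠ −1}` (`2 ≠ 0`), and the SIZE of the skew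
# parameter (`|x| < 1`, `= 1`, `> 1`) reads the position of `y` in the torus filtration (`|y − 1| < |2|`, the shallow window `[|2|, 1]`, the level `|2|`)
# (Weil 1964 §29; Serre, *Local Fields* V §3; O'Meara §63)

Topic `NumberTheory/LocalFields`; namespace `Literature.NumberTheory.LocalFields`.  THEOREMS ONLY (no definition, no instance, no notation, no named fact, no `sorry`;
axioms ⊆ {propext, Classical.choice, Quot.sound}).  Cell `pub/hodgecm-mathlib` (D-0151), crux H413 = `stmt-HodgeConjecture-24833`; half A line LH4, DYADIC pay-down leaf
`Cruxes/H413/Lines/F0_P3c_DyadicPaydown.lean`, organs (D-UNR)∕(D-RAM) (PRINT by ruling D74′).  HONEST READER LABEL: BANKED base layer, consumers none live; HC_CM is proved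
only modulo the 7 printed citations (2 remaining named inputs: hLiu418 = stmt-HodgeConjecture-24832, h413 = stmt-HodgeConjecture-24833) until rung 0 closes; generic valued-field
algebra, count-neutral, pays no letter by itself.

SETTING (= ★ `NormOneTorusCayleyLevelShift`).  `K` a field, `σ : K →+* K` a bare ring endomorphism; SKEW `σ x = −x`, NORM-ONE `σ y · y = 1`; `c(x) = (1 + x)∕(1 − x)`, inverse
`y ↦ (y − 1)∕(y + 1)`; from §2 on a valuation `Valued.v : K → Γ₀` (ANY value group) and, where stated, `|σ x| = |x|`.  ★ FILE 1 charted the DEEP torus `{|y − 1| < |2|}` by the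
open integral skew ball and proved the honesty trichotomy; THIS FILE charts the whole torus minus `−1` and turns the trichotomy into image equalities.

* §1 GLOBAL ALGEBRA (`2 ≠ 0`, no valuation).  `one_sub_ne_zero_of_map_eq_neg` ∕ `one_add_ne_zero_of_map_eq_neg`: a skew `x` has `1 ± x ≠ 0` (`x = ∓1` would be `σ`-fixed
  and skew, forcing `2 = 0`); `cayley_add_one_ne_zero` (`c(x) + 1 = 2∕(1 − x) ≠ 0`: `c` never hits `−1`); `map_cayley_mul_cayley_of_two_ne_zero` (skew ⇒ `c(x)` norm-one; the
  identity is ★ `Automorphic.map_cayley_mul_cayley` under `1 ± Z ≠ 0`, re-derived); `mapsTo_invCayley_normOne_skew` (norm-one, `y + 1 ≠ 0` ⇒ parameter skew; the identity is ★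
  `Automorphic.map_cayleyParam_eq_neg`, used as a local step); **`bijOn_cayley_skew_normOne`**: `c : {σ x = −x} ≃ {σ y · y = 1, y + 1 ≠ 0}` — the classical Cayley
  parametrisation of the norm-one torus minus `−1`; `image_cayley_skew`, `bijOn_invCayley_normOne_skew`; `cayley_sub_one_eq_mul` (`c(x) − 1 = x·(c(x) + 1)` — the one-line
  reason the parameter size reads the level); `cayley_inv_eq_neg_cayley` (`c(x⁻¹) = −c(x)`) and `map_inv_eq_neg_inv_of_map_eq_neg` (`x⁻¹` is skew with `x`).
* §2 THE SKEW CONSTRAINT AND THE LEVEL FORMULA (valued).  (F2) `valued_two_mul_le_valued_one_sub_of_map_eq_neg`: under an isometric `σ`, a skew `x` has `|2|·|x| ≤ |1 − x|`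
  (★ (C5) `|1 − x| = |1 + x|` and `2x = (1 + x) − (1 − x)`), so a skew UNIT has `|2| ≤ |1 − x| ≤ 1` (`…_of_valued_eq_one`); (F3) `valued_cayley_sub_one_eq_mul`
  (`|c(x) − 1| = |x|·|c(x) + 1|`), `valued_cayley_sub_one_mul_valued_one_sub` (`|c(x) − 1|·|1 − x| = |2|·|x|`), and the SHALLOW WINDOW `valued_cayley_sub_one_mem_of_valued_eq_one`:
  a skew unit parameter gives a torus element of level in `[|2|, 1]` — the converse half of ★ FILE 1 (T4) (`valued_invCayley_eq_one_of_two_lt`); (F4)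
  `valued_cayley_sub_one_of_one_lt`: a NON-INTEGRAL parameter (`|x| > 1`) gives level EXACTLY `|2|` (and `c(x) = −c(x⁻¹)` with `x⁻¹` in the open skew ball, §1: the level-`|2|`
  stratum contains `−T_{<|2|}` and `−1`).
* §3 THE THREE STRATA AS IMAGES.  Parameter size against `1` is `|y − 1|` against `|y + 1|` (`valued_lt_one_iff_of_cayleyParam` family via `x = (y − 1)∕(y + 1)`), and the `σ`-free
  level readings `valued_sub_one_lt_valued_add_one_iff` (`|y − 1| < |y + 1| ↔ |y − 1| < |2|`), `valued_add_one_lt_valued_sub_one_iff` (`|y + 1| < |y − 1| ↔ |y + 1| < |2|`);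
  **`bijOn_cayley_skew_normOne_of`** (the §1 bijection restricted along ANY predicate of `|x| = |y − 1|∕|y + 1|`) and its three instances **`image_cayley_skew_lt_one`**
  (open ball → `{|y − 1| < |y + 1|}` = the deep torus `{|y − 1| < |2|}` of ★ FILE 1), **`image_cayley_skew_eq_one`** (skew units → `{|y − 1| = |y + 1|}` ⊆ the window
  `[|2|, 1]`), **`image_cayley_skew_one_lt`** (non-integral → `{|y + 1| < |y − 1|}` = `{|y + 1| < |2|}` = `−T_{<|2|} `, inside the level-`|2|` stratum).  Together with `y = −1`
  (level `|−2| = |2|`) this is the whole torus.  TAME READING (`|2| = 1`): the window is the single level `0` and the deep torus is `T⁽¹⁾`.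
USE (none live; banked with ★ FILE 1 for the (D-RAM)∕(D-UNR) consumer re-bases M1∕M5 of the p06 census, and for any Euler–Poincaré ∕ fixed-point bookkeeping (M6) that
must see the shallow levels `0 … e` of `T = U(1)(L⁺_v)` at a dyadic place).

## References
* [Weil1964] A. Weil, *Sur certains groupes d'opérateurs unitaires*, Acta Math. 111 (1964), §29 (Cayley transform of unitary ∕ norm-one elements).
* [Serre1979] J.-P. Serre, *Local Fields*, GTM 67 (1979): Ch. V §3 (norm-one elements and their filtration), Ch. IV §2, Ch. XIV §4 (dyadic units).
* [Omeara1963] O. T. O'Meara, *Introduction to Quadratic Forms*, Grundlehren 117 (1963), §63 (dyadic local fields).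
-/

set_option autoImplicit false

noncomputable section

open scoped Valued
open WithZero

namespace Literature.NumberTheory.LocalFields

/-! ## §1 GLOBAL ALGEBRA: `c : {σ x = −x} ≃ {σ y · y = 1, y + 1 ≠ 0}` for `2 ≠ 0` -/

section Algebra

variable {K : Type*} [Field K] {σ : K →+* K}

/-- A skew element is not `1` when `2 ≠ 0`: `σ x = −x`, `x = 1` ⇒ `1 = −1`. [cite: Weil1964, §29] -/
theorem one_sub_ne_zero_of_map_eq_neg (h2 : (2 : K) ≠ 0) {x : K} (hσx : σ x = -x) : 1 - x ≠ 0 := fun h0 => by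
  have hx : x = 1 := (sub_eq_zero.1 h0).symm
  rw [hx, map_one] at hσx
  exact h2 (by linear_combination hσx)

/-- A skew element is not `−1` when `2 ≠ 0`: `σ x = −x`, `x = −1` ⇒ `−1 = 1`. [cite: Weil1964, §29] -/
theorem one_add_ne_zero_of_map_eq_neg (h2 : (2 : K) ≠ 0) {x : K} (hσx : σ x = -x) : 1 + x ≠ 0 := fun h0 => by
  have hx : x = -1 := (neg_eq_of_add_eq_zero_right h0).symm
  rw [hx, map_neg, map_one, neg_neg] at hσx
  exact h2 (by linear_combination -hσx)

/-- The Cayley map never hits `−1`: `c(x) + 1 = 2∕(1 − x) ≠ 0` (`1 − x ≠ 0`, `2 ≠ 0`). [cite: Weil1964, §29] -/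
theorem cayley_add_one_ne_zero (h2 : (2 : K) ≠ 0) {x : K} (hx : 1 - x ≠ 0) : (1 + x) / (1 - x) + 1 ≠ 0 := by
  rw [cayley_add_one hx]
  exact div_ne_zero h2 hx

/-- **`c(x) − 1 = x · (c(x) + 1)`** (`1 − x ≠ 0`): both sides are `2x∕(1 − x)` — the one-line reason why the SIZE of the parameter `x` compares `|c(x) − 1|` with `|c(x) + 1|`.
[cite: Omeara1963, §63] -/
theorem cayley_sub_one_eq_mul {x : K} (hx : 1 - x ≠ 0) : (1 + x) / (1 - x) - 1 = x * ((1 + x) / (1 - x) + 1) := by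
  rw [cayley_sub_one hx, cayley_add_one hx]
  ring

/-- SKEW ⇒ NORM-ONE, global form: `σ x = −x`, `2 ≠ 0` ⇒ `σ c(x) · c(x) = 1` (the identity ★ `Automorphic.map_cayley_mul_cayley`, whose hypotheses `1 ± x ≠ 0` hold here by
`one_sub∕one_add_ne_zero_of_map_eq_neg`). [cite: Weil1964, §29] -/
theorem map_cayley_mul_cayley_of_two_ne_zero (h2 : (2 : K) ≠ 0) {x : K} (hσx : σ x = -x) :
    σ ((1 + x) / (1 - x)) * ((1 + x) / (1 - x)) = 1 := by
  have hm := one_sub_ne_zero_of_map_eq_neg h2 hσx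
  have hp := one_add_ne_zero_of_map_eq_neg h2 hσx
  rw [map_div₀, map_add, map_sub, map_one, hσx, sub_neg_eq_add, ← sub_eq_add_neg]
  field_simp

/-- `c` maps the skew line into the norm-one torus minus `−1` (`2 ≠ 0`). [cite: Weil1964, §29] -/
theorem mapsTo_cayley_skew_normOne (h2 : (2 : K) ≠ 0) :
    Set.MapsTo (fun x : K => (1 + x) / (1 - x)) {x | σ x = -x} {y | σ y * y = 1 ∧ y + 1 ≠ 0} :=
  fun _ hx => ⟨map_cayley_mul_cayley_of_two_ne_zero h2 hx, cayley_add_one_ne_zero h2 (one_sub_ne_zero_of_map_eq_neg h2 hx)⟩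

/-- NORM-ONE ⇒ SKEW PARAMETER, global form: `σ y · y = 1`, `y + 1 ≠ 0` ⇒ `σ((y − 1)∕(y + 1)) = −(y − 1)∕(y + 1)` — `y ↦ (y − 1)∕(y + 1)` maps the torus minus `−1` into the skew
line (the identity is ★ `Automorphic.map_cayleyParam_eq_neg`, used here as a local step: `σ y = y⁻¹`). [cite: Weil1964, §29] -/
theorem mapsTo_invCayley_normOne_skew :
    Set.MapsTo (fun y : K => (y - 1) / (y + 1)) {y | σ y * y = 1 ∧ y + 1 ≠ 0} {x | σ x = -x} := by
  rintro y ⟨hy, hy1⟩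
  have hy0 : y ≠ 0 := fun h0 => by rw [h0, mul_zero] at hy; exact zero_ne_one hy
  have hσ : σ y = y⁻¹ := eq_inv_of_mul_eq_one_left hy
  have hσ1 : σ y + 1 ≠ 0 := by
    rw [hσ]; intro h0
    apply hy1
    have : y⁻¹ = -1 := eq_neg_of_add_eq_zero_left h0
    have hy' : y = -1 := by rw [← inv_inv y, this, inv_neg, inv_one]
    rw [hy']; ring
  have h1y : 1 + y ≠ 0 := by rwa [add_comm]
  show σ ((y - 1) / (y + 1)) = -((y - 1) / (y + 1))
  rw [map_div₀, map_sub, map_add, map_one, hσ]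
  field_simp
  ring

/-- The two maps are mutually inverse between the skew line and the torus minus `−1` (`2 ≠ 0`; ★ `invCayley_cayley`, ★ `cayley_invCayley`). [cite: Weil1964, §29] -/
theorem invOn_cayley_skew_normOne (h2 : (2 : K) ≠ 0) :
    Set.InvOn (fun y : K => (y - 1) / (y + 1)) (fun x : K => (1 + x) / (1 - x)) {x | σ x = -x} {y | σ y * y = 1 ∧ y + 1 ≠ 0} :=
  ⟨fun _ hx => invCayley_cayley (one_sub_ne_zero_of_map_eq_neg h2 hx) h2, fun _ hy => cayley_invCayley hy.2 h2⟩

/-- **THE CAYLEY PARAMETRISATION OF THE NORM-ONE TORUS**: for `2 ≠ 0`, `x ↦ (1 + x)∕(1 − x)` is a BIJECTION from the skew line `{σ x = −x}` onto the norm-one torus minus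
`−1`, `{σ y · y = 1, y + 1 ≠ 0}`, with inverse `y ↦ (y − 1)∕(y + 1)` (no valuation, no isometry, no involutivity needed). [cite: Weil1964, §29] [cite: Serre1979, Ch. V §3] -/
theorem bijOn_cayley_skew_normOne (h2 : (2 : K) ≠ 0) :
    Set.BijOn (fun x : K => (1 + x) / (1 - x)) {x | σ x = -x} {y | σ y * y = 1 ∧ y + 1 ≠ 0} :=
  (invOn_cayley_skew_normOne h2).bijOn (mapsTo_cayley_skew_normOne h2) mapsTo_invCayley_normOne_skew

/-- The image form: `c '' {σ x = −x} = {σ y · y = 1, y + 1 ≠ 0}` (`2 ≠ 0`). [cite: Weil1964, §29] -/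
theorem image_cayley_skew (h2 : (2 : K) ≠ 0) :
    (fun x : K => (1 + x) / (1 - x)) '' {x | σ x = -x} = {y | σ y * y = 1 ∧ y + 1 ≠ 0} :=
  (bijOn_cayley_skew_normOne h2).image_eq

/-- The inverse bijection: `y ↦ (y − 1)∕(y + 1)` from the torus minus `−1` onto the skew line (`2 ≠ 0`). [cite: Weil1964, §29] -/
theorem bijOn_invCayley_normOne_skew (h2 : (2 : K) ≠ 0) :
    Set.BijOn (fun y : K => (y - 1) / (y + 1)) {y | σ y * y = 1 ∧ y + 1 ≠ 0} {x | σ x = -x} :=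
  (invOn_cayley_skew_normOne h2).symm.bijOn mapsTo_invCayley_normOne_skew (mapsTo_cayley_skew_normOne h2)

/-- **`c(x⁻¹) = −c(x)`** (`x ≠ 0`, `x ≠ 1`): inverting the parameter negates the torus element — non-integral parameters are read off integral ones. [cite: Weil1964, §29] -/
theorem cayley_inv_eq_neg_cayley {x : K} (hx0 : x ≠ 0) (hx1 : 1 - x ≠ 0) : (1 + x⁻¹) / (1 - x⁻¹) = -((1 + x) / (1 - x)) := by
  have hx1' : x - 1 ≠ 0 := fun h0 => hx1 (by linear_combination -h0)
  field_simp
  ring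

/-- `x⁻¹` is skew with `x`: `σ x = −x ⇒ σ x⁻¹ = −x⁻¹`. [cite: Weil1964, §29] -/
theorem map_inv_eq_neg_inv_of_map_eq_neg {x : K} (hσx : σ x = -x) : σ x⁻¹ = -x⁻¹ := by
  rw [map_inv₀, hσx, inv_neg]

/-- A norm-one element stays norm-one under negation: `σ y · y = 1 ⇒ σ(−y)·(−y) = 1`. [cite: Weil1964, §29] -/
theorem map_neg_mul_neg_eq_one_of_map_mul_self_eq_one {y : K} (hy : σ y * y = 1) : σ (-y) * (-y) = 1 := by
  rw [map_neg, neg_mul_neg, hy]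

end Algebra

/-! ## §2 The skew constraint `|2|·|x| ≤ |1 − x|` and the level formula `|c(x) − 1|·|1 − x| = |2|·|x|` -/

section Valued

variable {K : Type*} [Field K] {Γ₀ : Type*} [LinearOrderedCommGroupWithZero Γ₀] [Valued K Γ₀] {σ : K →+* K}

/-- **(F2) THE SKEW CONSTRAINT**: under an isometric `σ`, a skew `x` has `|2|·|x| ≤ |1 − x|` — since `|1 − x| = |1 + x|` (★ (C5)) while `1 + x = (1 − x) + 2x`, a strict
inequality `|1 − x| < |2x|` would force `|1 + x| = |2x| ≠ |1 − x|`.  At `|2| = 1` this is `|x| ≤ |1 − x|` (trivial); at `|2| < 1` it says a skew element cannot be closer to `1`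
than `|2|·|x|`. [cite: Omeara1963, §63] [cite: Serre1979, Ch. V §3] -/
theorem valued_two_mul_le_valued_one_sub_of_map_eq_neg (hσv : ∀ x, Valued.v (σ x) = Valued.v x) {x : K} (hσx : σ x = -x) :
    Valued.v (2 : K) * Valued.v x ≤ Valued.v (1 - x) := by
  rw [← map_mul]
  refine le_of_not_gt fun hlt => ?_
  have h1 : Valued.v (1 + x) = Valued.v (2 * x) := by
    rw [show (1 + x : K) = 2 * x + (1 - x) by ring, Valuation.map_add_eq_of_lt_left _ hlt]
  rw [← valued_one_sub_eq_valued_one_add_of_map_eq_neg hσv hσx] at h1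
  exact (ne_of_lt hlt) h1

/-- (F2, units) A skew UNIT has `|2| ≤ |1 − x| ≤ 1`: at `|2| = exp(−e)` the order of `1 − x` lies in `[0, e]`. [cite: Omeara1963, §63] -/
theorem valued_one_sub_mem_of_map_eq_neg_of_valued_eq_one (hσv : ∀ x, Valued.v (σ x) = Valued.v x) {x : K} (hσx : σ x = -x)
    (hx : Valued.v x = 1) : Valued.v (2 : K) ≤ Valued.v (1 - x) ∧ Valued.v (1 - x) ≤ 1 := by
  refine ⟨?_, ?_⟩
  · have h := valued_two_mul_le_valued_one_sub_of_map_eq_neg hσv hσx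
    rwa [hx, mul_one] at h
  · calc Valued.v (1 - x) ≤ max (Valued.v (1 : K)) (Valued.v x) := Valuation.map_sub _ _ _
      _ = 1 := by rw [map_one, hx, max_self]

/-- **(F3) `|c(x) − 1| = |x|·|c(x) + 1|`** (`1 − x ≠ 0`; from `c(x) − 1 = x·(c(x) + 1)`): the parameter size IS the ratio of the distances of `c(x)` to `1` and to `−1`.
[cite: Omeara1963, §63] -/
theorem valued_cayley_sub_one_eq_mul {x : K} (hx : 1 - x ≠ 0) :
    Valued.v ((1 + x) / (1 - x) - 1) = Valued.v x * Valued.v ((1 + x) / (1 - x) + 1) := by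
  rw [cayley_sub_one_eq_mul hx, map_mul]

/-- (F3) `|c(x) − 1|·|1 − x| = |2|·|x|` (`1 − x ≠ 0`; `c(x) − 1 = 2x∕(1 − x)`) — the LEVEL FORMULA for an arbitrary parameter (★ (C1) is the case `|1 − x| = 1`).
[cite: Omeara1963, §63] -/
theorem valued_cayley_sub_one_mul_valued_one_sub {x : K} (hx : 1 - x ≠ 0) :
    Valued.v ((1 + x) / (1 - x) - 1) * Valued.v (1 - x) = Valued.v (2 : K) * Valued.v x := by
  rw [cayley_sub_one hx, map_div₀, map_mul, div_mul_cancel₀ _ ((Valuation.ne_zero_iff _).2 hx)]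

/-- (F3) `|c(x) + 1|·|1 − x| = |2|` (`1 − x ≠ 0`; `c(x) + 1 = 2∕(1 − x)`). [cite: Omeara1963, §63] -/
theorem valued_cayley_add_one_mul_valued_one_sub {x : K} (hx : 1 - x ≠ 0) :
    Valued.v ((1 + x) / (1 - x) + 1) * Valued.v (1 - x) = Valued.v (2 : K) := by
  rw [cayley_add_one hx, map_div₀, div_mul_cancel₀ _ ((Valuation.ne_zero_iff _).2 hx)]

/-- **(F3, THE SHALLOW WINDOW)**: under an isometric `σ` with `2 ≠ 0`, a skew UNIT parameter `x` (`|x| = 1`) gives a torus element `c(x)` of level in `[|2|, 1]`: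
`|2| ≤ |c(x) − 1| ≤ 1` (`|c(x) − 1| = |2|∕|1 − x|` with `|2| ≤ |1 − x| ≤ 1`, (F2)) — the converse half of ★ FILE 1 (T4) `valued_invCayley_eq_one_of_two_lt` ∕
`one_le_valued_invCayley_of_two_le`: the window `[|2|, 1]` of the torus is exactly what unit parameters chart. [cite: Omeara1963, §63] [cite: Serre1979, Ch. V §3] -/
theorem valued_cayley_sub_one_mem_of_valued_eq_one (hσv : ∀ x, Valued.v (σ x) = Valued.v x) (h2 : (2 : K) ≠ 0) {x : K} (hσx : σ x = -x)
    (hx : Valued.v x = 1) : Valued.v (2 : K) ≤ Valued.v ((1 + x) / (1 - x) - 1) ∧ Valued.v ((1 + x) / (1 - x) - 1) ≤ 1 := by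
  have hx1 : 1 - x ≠ 0 := one_sub_ne_zero_of_map_eq_neg h2 hσx
  obtain ⟨hlo, hhi⟩ := valued_one_sub_mem_of_map_eq_neg_of_valued_eq_one hσv hσx hx
  have hpos : 0 < Valued.v (1 - x) := zero_lt_iff.2 ((Valuation.ne_zero_iff _).2 hx1)
  have key : Valued.v ((1 + x) / (1 - x) - 1) * Valued.v (1 - x) = Valued.v (2 : K) := by
    rw [valued_cayley_sub_one_mul_valued_one_sub hx1, hx, mul_one]
  have hc : Valued.v ((1 + x) / (1 - x) - 1) = Valued.v (2 : K) / Valued.v (1 - x) := by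
    rw [eq_div_iff (ne_of_gt hpos), key]
  rw [hc]
  refine ⟨?_, ?_⟩
  · rw [le_div_iff₀ hpos]
    calc Valued.v (2 : K) * Valued.v (1 - x) ≤ Valued.v (2 : K) * 1 := mul_le_mul_right hhi _
      _ = Valued.v (2 : K) := mul_one _
  · rw [div_le_one₀ hpos]
    exact hlo

/-- `1 < |x| ⇒ |1 − x| = |x|` and `1 − x ≠ 0`. [cite: Omeara1963, §63] -/
theorem valued_one_sub_eq_of_one_lt {x : K} (hx : 1 < Valued.v x) : Valued.v (1 - x) = Valued.v x := by
  have h : Valued.v (1 : K) < Valued.v (-x) := by rwa [map_one, Valuation.map_neg]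
  rw [sub_eq_add_neg, Valuation.map_add_eq_of_lt_right _ h, Valuation.map_neg]

/-- **(F4) A NON-INTEGRAL parameter gives level EXACTLY `|2|`**: `1 < |x| ⇒ |c(x) − 1| = |2|` (`c(x) − 1 = 2x∕(1 − x)`, `|1 − x| = |x|`); with `c(x) = −c(x⁻¹)` (§1) and `x⁻¹`
in the open skew ball this says `−T_{<|2|}` sits inside the level-`|2|` stratum, next to `−1` itself (`|−1 − 1| = |2|`). [cite: Omeara1963, §63] [cite: Serre1979, Ch. V §3] -/
theorem valued_cayley_sub_one_of_one_lt {x : K} (hx : 1 < Valued.v x) : Valued.v ((1 + x) / (1 - x) - 1) = Valued.v (2 : K) := by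
  have hx0 : Valued.v x ≠ 0 := ne_of_gt (lt_trans zero_lt_one hx)
  have hx1 : 1 - x ≠ 0 := fun h0 => by
    have h := valued_one_sub_eq_of_one_lt hx
    rw [h0, map_zero] at h
    exact hx0 h.symm
  rw [cayley_sub_one hx1, map_div₀, map_mul, valued_one_sub_eq_of_one_lt hx, mul_div_cancel_right₀ _ hx0]

/-- The element `−1` of the torus has level `|2|`: `|−1 − 1| = |2|`. [cite: Omeara1963, §63] -/
theorem valued_neg_one_sub_one : Valued.v ((-1 : K) - 1) = Valued.v (2 : K) := by
  rw [show ((-1 : K) - 1) = -2 by ring, Valuation.map_neg]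

/-! ## §3 The three strata of the torus as Cayley images: parameter size against `1` = `|y − 1|` against `|y + 1|` -/

/-- `σ`-free LEVEL READING I: `|y − 1| < |y + 1| ↔ |y − 1| < |2|` (`y + 1 = (y − 1) + 2`). [cite: Omeara1963, §63] -/
theorem valued_sub_one_lt_valued_add_one_iff (y : K) : Valued.v (y - 1) < Valued.v (y + 1) ↔ Valued.v (y - 1) < Valued.v (2 : K) := by
  constructor
  · intro h
    refine lt_of_not_ge fun h2 => ?_
    have hle : Valued.v (y + 1) ≤ Valued.v (y - 1) := by
      calc Valued.v (y + 1) ≤ max (Valued.v (2 : K)) (Valued.v (y - 1)) := valued_add_one_le_max y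
        _ = Valued.v (y - 1) := max_eq_right h2
    exact (not_le_of_gt h) hle
  · intro h
    rw [valued_add_one_eq_two h]
    exact h

/-- `σ`-free LEVEL READING II: `|y + 1| < |y − 1| ↔ |y + 1| < |2|` (`y − 1 = (y + 1) − 2`; equivalently `−y` is in the deep torus). [cite: Omeara1963, §63] -/
theorem valued_add_one_lt_valued_sub_one_iff (y : K) : Valued.v (y + 1) < Valued.v (y - 1) ↔ Valued.v (y + 1) < Valued.v (2 : K) := by
  have h := valued_sub_one_lt_valued_add_one_iff (-y)
  rw [show (-y - 1 : K) = -(y + 1) by ring, show (-y + 1 : K) = -(y - 1) by ring, Valuation.map_neg, Valuation.map_neg] at h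
  exact h

/-- **THE §1 BIJECTION RESTRICTED ALONG ANY PREDICATE OF THE PARAMETER SIZE**: for `2 ≠ 0` and `P : Γ₀ → Prop`, `c` is a bijection from `{σ x = −x, P |x|}` onto
`{σ y · y = 1, y + 1 ≠ 0, P (|y − 1|∕|y + 1|)}` — because the parameter of `y` is `(y − 1)∕(y + 1)`. [cite: Weil1964, §29] [cite: Omeara1963, §63] -/
theorem bijOn_cayley_skew_normOne_of (h2 : (2 : K) ≠ 0) (P : Γ₀ → Prop) :
    Set.BijOn (fun x : K => (1 + x) / (1 - x)) {x | σ x = -x ∧ P (Valued.v x)}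
      {y | σ y * y = 1 ∧ y + 1 ≠ 0 ∧ P (Valued.v (y - 1) / Valued.v (y + 1))} := by
  refine ((invOn_cayley_skew_normOne h2).mono (fun _ hx => hx.1) (fun _ hy => ⟨hy.1, hy.2.1⟩)).bijOn ?_ ?_
  · rintro x ⟨hσx, hP⟩
    obtain ⟨hn, hn1⟩ := mapsTo_cayley_skew_normOne h2 hσx
    refine ⟨hn, hn1, ?_⟩
    rw [← map_div₀, invCayley_cayley (one_sub_ne_zero_of_map_eq_neg h2 hσx) h2]
    exact hP
  · rintro y ⟨hy, hy1, hP⟩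
    refine ⟨mapsTo_invCayley_normOne_skew ⟨hy, hy1⟩, ?_⟩
    show P (Valued.v ((y - 1) / (y + 1)))
    rw [map_div₀]
    exact hP

/-- **(F5, DEEP STRATUM) `c '' {σ x = −x, |x| < 1} = {σ y · y = 1, y + 1 ≠ 0, |y − 1| < |y + 1|}`** (`2 ≠ 0`) — by `valued_sub_one_lt_valued_add_one_iff` the right side is the
deep torus `{|y − 1| < |2|}` of ★ FILE 1 `bijOn_cayley_skew_ball` (there `y + 1 ≠ 0` is automatic). [cite: Serre1979, Ch. V §3] [cite: Omeara1963, §63] -/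
theorem image_cayley_skew_lt_one (h2 : (2 : K) ≠ 0) :
    (fun x : K => (1 + x) / (1 - x)) '' {x | σ x = -x ∧ Valued.v x < 1} =
      {y | σ y * y = 1 ∧ y + 1 ≠ 0 ∧ Valued.v (y - 1) < Valued.v (y + 1)} := by
  rw [(bijOn_cayley_skew_normOne_of h2 (· < 1)).image_eq]
  ext y
  simp only [Set.mem_setOf_eq]
  refine ⟨fun ⟨hy, hy1, hP⟩ => ⟨hy, hy1, ?_⟩, fun ⟨hy, hy1, hP⟩ => ⟨hy, hy1, ?_⟩⟩
  · rwa [div_lt_one₀ (zero_lt_iff.2 ((Valuation.ne_zero_iff _).2 hy1))] at hP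
  · rwa [div_lt_one₀ (zero_lt_iff.2 ((Valuation.ne_zero_iff _).2 hy1))]

/-- **(F5, SHALLOW WINDOW) `c '' {σ x = −x, |x| = 1} = {σ y · y = 1, y + 1 ≠ 0, |y − 1| = |y + 1|}`** (`2 ≠ 0`): the skew UNITS chart the torus elements equidistant from
`1` and `−1` — by (F3)∕(F2) these have level in `[|2|, 1]`, and by ★ FILE 1 (T4) every level in `(|2|, 1]` is of this kind. [cite: Serre1979, Ch. V §3] [cite: Omeara1963, §63] -/
theorem image_cayley_skew_eq_one (h2 : (2 : K) ≠ 0) :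
    (fun x : K => (1 + x) / (1 - x)) '' {x | σ x = -x ∧ Valued.v x = 1} =
      {y | σ y * y = 1 ∧ y + 1 ≠ 0 ∧ Valued.v (y - 1) = Valued.v (y + 1)} := by
  rw [(bijOn_cayley_skew_normOne_of h2 (· = 1)).image_eq]
  ext y
  simp only [Set.mem_setOf_eq]
  refine ⟨fun ⟨hy, hy1, hP⟩ => ⟨hy, hy1, ?_⟩, fun ⟨hy, hy1, hP⟩ => ⟨hy, hy1, ?_⟩⟩
  · rwa [div_eq_one_iff_eq ((Valuation.ne_zero_iff _).2 hy1)] at hP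
  · rwa [div_eq_one_iff_eq ((Valuation.ne_zero_iff _).2 hy1)]

/-- **(F5, LEVEL `|2|` FROM OUTSIDE) `c '' {σ x = −x, 1 < |x|} = {σ y · y = 1, y + 1 ≠ 0, |y + 1| < |y − 1|}`** (`2 ≠ 0`) — by `valued_add_one_lt_valued_sub_one_iff` the
right side is `{|y + 1| < |2|} = −T_{<|2|}`, of level exactly `|2|` ((F4)). [cite: Serre1979, Ch. V §3] [cite: Omeara1963, §63] -/
theorem image_cayley_skew_one_lt (h2 : (2 : K) ≠ 0) :
    (fun x : K => (1 + x) / (1 - x)) '' {x | σ x = -x ∧ 1 < Valued.v x} =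
      {y | σ y * y = 1 ∧ y + 1 ≠ 0 ∧ Valued.v (y + 1) < Valued.v (y - 1)} := by
  rw [(bijOn_cayley_skew_normOne_of h2 (1 < ·)).image_eq]
  ext y
  simp only [Set.mem_setOf_eq]
  refine ⟨fun ⟨hy, hy1, hP⟩ => ⟨hy, hy1, ?_⟩, fun ⟨hy, hy1, hP⟩ => ⟨hy, hy1, ?_⟩⟩
  · rwa [one_lt_div₀ (zero_lt_iff.2 ((Valuation.ne_zero_iff _).2 hy1))] at hP
  · rwa [one_lt_div₀ (zero_lt_iff.2 ((Valuation.ne_zero_iff _).2 hy1))]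

/-- (F5, exhaustion) For a norm-one `y ≠ −1` exactly one of `|y − 1| < |y + 1|`, `=`, `>` holds, so the three images above PARTITION the torus minus `−1`; with `2 ≠ 0` every
such `y` is `c(x)` for the unique skew `x = (y − 1)∕(y + 1)`, integral non-unit ∕ unit ∕ non-integral respectively. [cite: Serre1979, Ch. V §3] -/
theorem exists_unique_skew_cayley_eq_of_map_mul_self_eq_one (h2 : (2 : K) ≠ 0) {y : K} (hy : σ y * y = 1) (hy1 : y + 1 ≠ 0) :
    ∃! x : K, σ x = -x ∧ (1 + x) / (1 - x) = y :=
  ⟨(y - 1) / (y + 1), ⟨mapsTo_invCayley_normOne_skew ⟨hy, hy1⟩, cayley_invCayley hy1 h2⟩,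
    fun x ⟨hσx, hx⟩ => by rw [← hx, invCayley_cayley (one_sub_ne_zero_of_map_eq_neg h2 hσx) h2]⟩

end Valued

end Literature.NumberTheory.LocalFields
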